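import Summits.AtomisticToContinuum.Crystallization.Theses.HcpThetaUniversality
import Literature.Barriers.AtomisticToContinuum.TetrahedralFrustration

/-!
# Birth skeleton (BC3) for crux `HcpThetaMaxPackings` (stmt-AtomisticToContinuum-5056) — line `birth`

Route `HcpThetaUniversality`, sub-problem `Crystallization`; registrar
`planner-skel-stmt-AtomisticToContinuum-5056-0` (2026-08-17, skeleton-register, gen 1).

The crux (Θ-PACK, finite averaged form): for every Gaussian parameter `t > 0` and every finite unit
packing `x : Fin N → ℝ³` (pairwise distances `≥ 1`),
`∑_i ∑_{j ≠ i} e^{-t·dist(x_i,x_j)²} ≤ N · θ_hcp(t)`, `θ_hcp(t) = gaussianEnergy t (hcpStacking 1 √(2/3))`.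

## The line: PERIODIC REDUCTION with the Kepler endpoint isolated

The finite averaged extremal problem is moved to the category of PERIODIC unit packings
(`PeriodicConfiguration 3` whose point set `F + G` has pairwise distances `≥ 1`), where two things the
finite form lacks exist: a NUMBER DENSITY `#F / covol(G)` (bounded by `√2` = hcp's density at
nearest-neighbour distance `1`, by Kepler/Hales), and a FOURIER SIDE (Poisson summation over the dual
lattice `G*`: `2 e_P(t) + 1 = (#F/covol G)(π/t)^{3/2} ∑_{k ∈ G*} |S_F(k)|²/#F² · e^{-π²|k|²/t}`, all terms
`≥ 0`, the `k = 0` term being the density term that Kepler controls).  Four registered stubs: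

* `stub_periodise` (M–L, provable now): a finite unit packing of `N ≥ 1` points periodises — lattice
  `L·ℤ³` with `L >` diameter `+ 1`, motif `= range x` — into a periodic unit packing `P` whose Gaussian
  energy per particle dominates the finite average: `∑_i ∑_{j≠i} e^{-t d²} ≤ N · 2 e_P(t)` (the periodic
  images only ADD non-negative terms; needs the summability of the Gaussian over a uniformly discrete
  periodic set, cf. `summable_inv_pow_six_hcpStacking` in
  `Theorems/HcpThetaUniversalityThetaMaxImpliesSutherlandBound.lean` for the pattern).
* `stub_kepler` (NAMED FACT, Flyspeck): `Literature.Barriers.AtomisticToContinuum.Hales_kepler`.  The crux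
  as filed is unconditional but IMPLIES the Kepler bound (its `t → 0` endpoint: by positive-definiteness
  of the Gaussian, `(1/N)∑_{i≠j} e^{-t d²} ≥ ρ (π/t)^{3/2} − 1 − o(1)` for large clusters of a packing of
  number density `ρ`, while `θ_hcp(t) = √2 (π/t)^{3/2} − 1 + O(e^{-c/t})`), so EVERY proof of the crux
  uses Kepler; this stub is where the line uses it (honest obstruction bookkeeping; the tenure planner may
  prefer to restate the crux as `Hales_kepler → …`).
* `stub_periodicDensity` (L, provable now from the named fact): `Hales_kepler →` every periodic unit
  packing has `#F ≤ √2 · covol(G)` (scale by `2` to a unit-ball packing, `Hales_kepler_iff_card_bound`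
  of `TetrahedralFrustrationKeplerProofs.lean`, and lattice-point counting
  `#((F+G) ∩ B_r) / vol(B_r) → #F / covol G`, Mathlib `ZLattice.covolume`).
* `stub_periodicThetaBound` (open — the load-bearing stub): for every `t > 0` and every periodic unit
  packing of density `≤ √2`, `2 e_P(e^{-t r²}) ≤ θ_hcp(t)`.  With the density hypothesis this stub NO
  LONGER implies Kepler (it is silent on denser periodic sets), so it is the Flyspeck-free remainder of
  the crux; hcp attains equality (`2 e_hcp = θ_hcp`, both hcp sites are equivalent), fcc and every
  Barlow stacking lose (`BarlowThetaDominance`, proved, item 5060), bcc/sc/A15 lose numerically (route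
  header); the why-easier is the Fourier side above (density term free, the rest a comparison of
  non-negative dual-lattice sums) and the compactness of periodic configurations of bounded period.

Composition (`hcpThetaMaxPackings_of_stubs`, sorry-free): `N = 0` is `0 ≤ 0`; for `N ≥ 1` periodise
(`stub_periodise`), bound the density of the periodised packing (`stub_periodicDensity stub_kepler`), apply
`stub_periodicThetaBound` and multiply by `N`.  `HcpThetaMaxPackings_of` concludes the route decl BY NAME.

Disproof used: none on file (`ledger crux ls stmt-AtomisticToContinuum-5056`: no Disproof.lean, no dead
lines, negatives index of the summit empty for this decl).  Barriers: `NoUniversallyOptimalLattice3D`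
(density-constrained universality fails in `d = 3`) does not bite — the competitor class is
packing-constrained and the density enters only as an upper bound; `Li2022_cohnElkies3D` (no sharp LP in
`d = 3`) is not invoked — no two-point certificate is posited; `TetrahedralFrustration` concerns
single-cell density bounds — Kepler enters as the named fact, not re-proved cell by cell.
-/

noncomputable section

namespace Summit.AtomisticToContinuum.Crystallization.Cruxes.HcpThetaMaxPackings.Birth

open Literature.MathematicalPhysics.StatisticalMechanics
open Literature.Barriers.AtomisticToContinuum

/-- **stub_periodise** (M–L; periodisation of a finite unit packing).  For every `t > 0` and every unit
packing `x` of `N ≥ 1` points of `ℝ³` there is a periodic configuration `P` whose point set is a unit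
packing (pairwise distances `≥ 1`) and whose Gaussian energy per particle dominates the finite average:
`∑_i ∑_{j ≠ i} e^{-t·dist(x_i,x_j)²} ≤ N · (2 · e_P(r ↦ e^{-t r²}))`.  Construction: periods `L·ℤ³` with
`L = diam(x) + 2`, motif `Finset.image x univ` (card `N` by injectivity from the distance bound); images
in different cells are `≥ L − diam ≥ 1` apart; the energy of `P` is the finite double sum plus the
(non-negative, summable) image terms. -/
theorem stub_periodise :
    ∀ t : ℝ, 0 < t → ∀ (N : ℕ) (x : Fin N → EuclideanSpace ℝ (Fin 3)), 0 < N →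
      (∀ i j, i ≠ j → 1 ≤ dist (x i) (x j)) →
      ∃ P : PeriodicConfiguration 3,
        (∀ p ∈ P.points, ∀ q ∈ P.points, p ≠ q → 1 ≤ dist p q) ∧
        ∑ i, ∑ j ∈ Finset.univ.erase i, Real.exp (-t * dist (x i) (x j) ^ 2) ≤
          (N : ℝ) * (2 * P.energyPerParticle (fun r => Real.exp (-t * r ^ 2))) := by
  sorry

/-- **stub_kepler** (NAMED FACT — the Kepler conjecture, Hales–Ferguson / Flyspeck, in Hales's precise
sense `δ(V, 0, r) ≤ π/√18 + c/r` for saturated unit-ball packings; vendored once in the tree as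
`Literature.Barriers.AtomisticToContinuum.Hales_kepler`, HalesDSP2012 Thm 6.9, HalesEtAl2015 §3).  The
crux implies the Kepler density bound at its `t → 0` endpoint, so the line must use it; it is used
exactly here, feeding `stub_periodicDensity`. -/
theorem stub_kepler : Hales_kepler := by
  sorry

/-- **stub_periodicDensity** (L; Kepler for periodic unit packings, from the named fact).  If
`Hales_kepler` holds then every periodic configuration of `ℝ³` whose point set `F + G` has pairwise
distances `≥ 1` has at most `√2 · covol(G)` motif points (number density `≤ √2`, the density of hcp/fcc at
nearest-neighbour distance `1`): `2·(F + G)` is a unit-ball packing, `Hales_kepler_iff_card_bound` gives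
`#((F+G) ∩ B_s) ≤ √2·(4π/3)s³ + 4c s²`, and `#((F+G) ∩ B_s)/((4π/3)s³) → #F/covol(G)` (one motif point
per `G`-orbit and fundamental domain; Mathlib `ZLattice.covolume`). -/
theorem stub_periodicDensity :
    Hales_kepler → ∀ P : PeriodicConfiguration 3,
      (∀ p ∈ P.points, ∀ q ∈ P.points, p ≠ q → 1 ≤ dist p q) →
      (P.motif.card : ℝ) ≤ Real.sqrt 2 * ZLattice.covolume P.lattice := by
  sorry

/-- **stub_periodicThetaBound** (open-problem; LOAD-BEARING).  For every `t > 0` and every periodic unit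
packing `P = F + G` of `ℝ³` of number density `≤ √2` (automatic, by `stub_periodicDensity`), twice the
Gaussian energy per particle is at most hcp's theta value at nearest-neighbour distance `1`:
`2 e_P(r ↦ e^{-t r²}) = (#F)⁻¹ ∑_{x ∈ F} ∑_{y ∈ F+G, y ≠ x} e^{-t|x−y|²} ≤ θ_hcp(t)`.  Equality for
`P = hcp`; every other Barlow stacking loses sitewise (`BarlowThetaDominance`, item 5060, proved).
Why it might fail: a non-Barlow periodic packing rich in near-contacts in `(1.046, √2)` (DLP clusters,
Frank–Kasper phases) winning at `t ≈ 1–5` — the crux's own falsifier, now over a compact family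
(bounded period) where it can be searched (refuter job j001160: `n ≤ 8` atoms/cell, no exceedance). -/
theorem stub_periodicThetaBound :
    ∀ t : ℝ, 0 < t → ∀ P : PeriodicConfiguration 3,
      (∀ p ∈ P.points, ∀ q ∈ P.points, p ≠ q → 1 ≤ dist p q) →
      (P.motif.card : ℝ) ≤ Real.sqrt 2 * ZLattice.covolume P.lattice →
      2 * P.energyPerParticle (fun r => Real.exp (-t * r ^ 2)) ≤
        gaussianEnergy t (hcpStacking 1 (Real.sqrt (2 / 3))) := by
  sorry

/-- **Composition** (sorry-free): the four stub statements imply the crux body.  `N = 0`: both sides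
vanish.  `N ≥ 1`: periodise (`h₁`), bound the density of the periodised packing by Kepler (`h₃ h₂`),
apply the periodic theta bound (`h₄`) and multiply by `N ≥ 0`. -/
theorem hcpThetaMaxPackings_of_stubs
    (h₁ : ∀ t : ℝ, 0 < t → ∀ (N : ℕ) (x : Fin N → EuclideanSpace ℝ (Fin 3)), 0 < N →
      (∀ i j, i ≠ j → 1 ≤ dist (x i) (x j)) →
      ∃ P : PeriodicConfiguration 3,
        (∀ p ∈ P.points, ∀ q ∈ P.points, p ≠ q → 1 ≤ dist p q) ∧
        ∑ i, ∑ j ∈ Finset.univ.erase i, Real.exp (-t * dist (x i) (x j) ^ 2) ≤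
          (N : ℝ) * (2 * P.energyPerParticle (fun r => Real.exp (-t * r ^ 2))))
    (h₂ : Hales_kepler)
    (h₃ : Hales_kepler → ∀ P : PeriodicConfiguration 3,
      (∀ p ∈ P.points, ∀ q ∈ P.points, p ≠ q → 1 ≤ dist p q) →
      (P.motif.card : ℝ) ≤ Real.sqrt 2 * ZLattice.covolume P.lattice)
    (h₄ : ∀ t : ℝ, 0 < t → ∀ P : PeriodicConfiguration 3,
      (∀ p ∈ P.points, ∀ q ∈ P.points, p ≠ q → 1 ≤ dist p q) →
      (P.motif.card : ℝ) ≤ Real.sqrt 2 * ZLattice.covolume P.lattice →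
      2 * P.energyPerParticle (fun r => Real.exp (-t * r ^ 2)) ≤
        gaussianEnergy t (hcpStacking 1 (Real.sqrt (2 / 3)))) :
    ∀ t : ℝ, 0 < t → ∀ (N : ℕ) (x : Fin N → EuclideanSpace ℝ (Fin 3)),
      (∀ i j, i ≠ j → 1 ≤ dist (x i) (x j)) →
      ∑ i, ∑ j ∈ Finset.univ.erase i, Real.exp (-t * dist (x i) (x j) ^ 2) ≤
        (N : ℝ) * gaussianEnergy t (hcpStacking 1 (Real.sqrt (2 / 3))) := by
  intro t ht N x hx
  rcases Nat.eq_zero_or_pos N with hN | hN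
  · -- no particles: the double sum is empty and the right-hand side is `0 · θ = 0`
    subst hN
    simp
  · -- periodise, bound the density by Kepler, apply the periodic theta bound, multiply by `N`
    obtain ⟨P, hP, hle⟩ := h₁ t ht N x hN hx
    have hdens : (P.motif.card : ℝ) ≤ Real.sqrt 2 * ZLattice.covolume P.lattice := h₃ h₂ P hP
    have hθ : 2 * P.energyPerParticle (fun r => Real.exp (-t * r ^ 2)) ≤
        gaussianEnergy t (hcpStacking 1 (Real.sqrt (2 / 3))) := h₄ t ht P hP hdens
    calc ∑ i, ∑ j ∈ Finset.univ.erase i, Real.exp (-t * dist (x i) (x j) ^ 2)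
        ≤ (N : ℝ) * (2 * P.energyPerParticle (fun r => Real.exp (-t * r ^ 2))) := hle
      _ ≤ (N : ℝ) * gaussianEnergy t (hcpStacking 1 (Real.sqrt (2 / 3))) :=
          mul_le_mul_of_nonneg_left hθ (Nat.cast_nonneg N)

/-- **The crux BY NAME from the registered stubs**:
`stub_periodise → stub_kepler → stub_periodicDensity → stub_periodicThetaBound → HcpThetaMaxPackings`
(the implication is `hcpThetaMaxPackings_of_stubs`; here it is applied to the four stubs, so the only
`sorry`s of this file sit inside `stub_*`). -/
theorem HcpThetaMaxPackings_of :
    Summit.AtomisticToContinuum.Crystallization.Theses.HcpThetaUniversality.HcpThetaMaxPackings :=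
  hcpThetaMaxPackings_of_stubs stub_periodise stub_kepler stub_periodicDensity stub_periodicThetaBound

end Summit.AtomisticToContinuum.Crystallization.Cruxes.HcpThetaMaxPackings.Birth

end
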